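import Summits.BirchSwinnertonDyer.BirchSwinnertonDyer.Theorems.ThetaPartnerAtTwoSignedControlAtTwoShaTwoPrimaryFinite
import Summits.BirchSwinnertonDyer.BirchSwinnertonDyer.Theorems.ThetaPartnerAtTwoSignedControlAtTwoResTwoOfShaTwo
import Literature.NumberTheory.GaloisRepresentations.ContinuousCohomologyNineTerm
import Literature.NumberTheory.GaloisCohomology.PoitouTateRealPlacesHigherDegree
import Literature.NumberTheory.EllipticCurves.KummerSequenceConnecting
import Summits.BirchSwinnertonDyer.Rank1Residual.X11b.LevelShiftMaps
import HarnessLib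

/-!
# `Ш²(K, E[p^∞])` is `p`-DIVISIBLE — relative exactness `H²(M₂) → H²(M₃) → H³(M₁)` detected at the real places —
# hence `Ш²(ℚ, E[2^∞]) = 0` on the K4 row (K4 Prop-4.12 elimination lane, part 4b)

Route `ThetaPartnerAtTwo` (TP2; crux shared with `ResidualThetaTransportAtTwo`), crux K4 `SignedControlAtTwo`
(stmt-BirchSwinnertonDyer-20309), line `eulerchar` v10. Seat `prover-bsd-wall-tp2-p3-w2` (width seat 2/3, gen 5).

Part 4a (`…ShaTwoPrimaryFinite`) proved `Ш²(K, E[p^∞])` FINITE (granted Poitou–Tate duality of `Ш` at finite level).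
This file proves it `p`-DIVISIBLE, granted the two ARCHIMEDEAN rows of Poitou–Tate (Milne, *ADT*, I Thm. 4.10 (c) for
`r = 3` and I Cor. 4.16: `H³(K, M) ↪ ⊕_{v real} H³(K_v, M)`, `H²(K, M) ↠ ⊕_{v real} H²(K_v, M)` for finite `M`; tree
named facts `poitouTate_three_realPlaces_injective`, `poitouTate_two_realPlaces_surjective`), and concludes
`Ш²(ℚ, E[2^∞]) = 0` for the curves of the K4 row. This is Milne's proof of *ADT* I Thm. 6.13 (c)
(`H²(G_S, E[p^∞]) → ⊕_{v real} H²(K_v, E)_{p^∞}` is onto with finite kernel `Ш²`; over a row where `Sel_{p^∞}` is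
finite the kernel is `0`), made cochain-level:

* §1 `IsSES.exists_map_two_eq_of_forall_localization_inl` — **relative exactness at `H²(Γ_K, M₃)`** for a short
  exact `0 → M₁ → M₂ → M₃ → 0` of discrete `Γ_K`-modules: a class `x ∈ H²(K, M₃)` LOCALLY TRIVIAL AT THE INFINITE PLACES
  lifts to `H²(K, M₂)` as soon as `H³(K, M₁)` is detected at the infinite places (`∂x` localises to `∂(x|_{K_w}) = 0`;
  the tree's `exists_map_two_eq_of_subsingleton_three` is the case `H³ = 0`);
* §2 `exists_two_smul_eq_of_mem_shaTwo` — every `c ∈ Ш²(K, E[p^∞])` is `p · c'` for some `c' ∈ H²(K, E[p^∞])`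
  trivial at the infinite places (finite-level halving along `0 → E[p] → E[p·p^M] →ᵖ E[p^M] → 0`, the real-place
  surjectivity correcting the lift), and `c' ∈ Ш²` as soon as the local `H²(K_v, E[p^∞])` vanish at the finite places;
* §3 over `ℚ`, `p = 2`, `GoodSS W 2`: **`forall_mem_shaTwo_two_primary_eq_zero_of_goodSS`** — `Ш²(ℚ, E[2^∞]) = 0` when
  `Sel_{2^∞}(E/ℚ)` is finite (finite + `2`-primary + `2`-divisible); the input `hres` of part 2 discharged:
  **`resTwo_injective_of_goodSS`**.
HONEST FRAMING: THEOREMS ONLY (no definition, no named fact, no `sorry`); CONDITIONAL on the cited facts `poitouTate_sha_tateDual ℚ`,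
`poitouTate_three_realPlaces_injective ℚ`, `poitouTate_two_realPlaces_surjective ℚ` (hypotheses); closes no item; BSD is not proved.

References: [MilneADT2006] I Thm. 4.10 (c), Cor. 4.16, Lemma 6.12, Thm. 6.13 (c); [SerreGaloisCohomology1997] I §2.2;
[Harari2020] Thm. 17.13; [GreenbergLNM1716] §4 (Prop. 4.12 is what this lane removes).
-/

set_option autoImplicit false
-- the Theorems namespace of this sub repeats the summit name by design (D-0017 nested layout)
set_option linter.dupNamespace false

noncomputable section

open scoped Classical NumberField ContRepresentation

open CategoryTheory NumberField IsDedekindDomain Field Function WeierstrassCurve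
open _root_.TopRep _root_.ContRepresentation _root_.ContinuousCohomology
open Literature.NumberTheory.EllipticCurves Literature.NumberTheory.GaloisRepresentations
open Literature.NumberTheory.GaloisRepresentations.DiscreteGaloisModule (sha shaTwo mem_sha_iff mem_shaTwo_iff tateDual)
open Literature.NumberTheory.GaloisCohomology
open Summit.BirchSwinnertonDyer.Rank1Residual.X11b (LocBridge.primaryGaloisModule)
open Summit.BirchSwinnertonDyer.Rank1Residual.X11b.Levels (primaryInclusion)

namespace Summit.BirchSwinnertonDyer.BirchSwinnertonDyer.Theorems.SignedEC.ShaTwo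

/-! ## §1 Relative exactness at `H²(Γ_K, M₃)`, the obstruction detected at the infinite places -/

section RelativeExactness

variable {K : Type} [Field K] [NumberField K]
variable {M₁ M₂ M₃ : Type} [AddCommGroup M₁] [TopologicalSpace M₁] [DiscreteTopology M₁]
  [AddCommGroup M₂] [TopologicalSpace M₂] [DiscreteTopology M₂]
  [AddCommGroup M₃] [TopologicalSpace M₃] [DiscreteTopology M₃]
variable {ρ₁ : DiscreteGaloisModule K M₁} {ρ₂ : DiscreteGaloisModule K M₂} {ρ₃ : DiscreteGaloisModule K M₃}
variable {f : ρ₁.toTopRep ⟶ ρ₂.toTopRep} {g : ρ₂.toTopRep ⟶ ρ₃.toTopRep}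

/-- **Relative exactness at `H²(Γ_K, M₃)`.** For a short exact sequence `0 → M₁ →f M₂ →g M₃ → 0` of discrete
`Γ_K`-modules over a number field `K` such that `H³(K, M₁) → ∏_{w ∣ ∞} H³(K_w, M₁)` is injective, every class
`x ∈ H²(K, M₃)` whose localisations at all infinite places vanish is in the image of `H²(g)`.  (Cochain proof, as in
the tree's `exists_map_two_eq_of_subsingleton_three`: lift a cocycle `z` of `x` to a continuous cochain `z̃` of `M₂`;
the obstruction `c = f⁻¹(d z̃) ∈ Z³(Γ_K, M₁)` has, at each infinite `w`, the restriction `d(f⁻¹(z̃|_w - d b̃_w))` where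
`z|_w = d b_w` and `b̃_w` lifts `b_w` — so `[c]|_w = 0`, hence `[c] = 0`, `c = db`, and `z̃ - f∘b` lifts `z`.)
[cite: SerreGaloisCohomology1997, I §2.2] [cite: MilneADT2006, Ch. I, Thm. 4.10 (c)] -/
theorem IsSES.exists_map_two_eq_of_forall_localization_inl (h : IsSES f g)
    (h3 : ∀ c : galoisCohomology ρ₁ 3,
      (∀ w : InfinitePlace K, galoisCohomology.localization ρ₁ (Sum.inl w) 3 c = 0) → c = 0)
    (x : galoisCohomology ρ₃ 2)
    (hx : ∀ w : InfinitePlace K, galoisCohomology.localization ρ₃ (Sum.inl w) 2 x = 0) :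
    ∃ y : galoisCohomology ρ₂ 2, cohomologyMap g 2 y = x := by
  haveI : CompactSpace (absoluteGaloisGroup K) := absoluteGaloisGroup_compactSpace K
  obtain ⟨z, rfl⟩ := twoCocycleClass_surjective _ x
  let zt : C(absoluteGaloisGroup K × absoluteGaloisGroup K, M₂) :=
    ⟨h.lift ∘ z.1, (continuous_of_discreteTopology (f := h.lift)).comp z.1.continuous⟩
  have hzt : ∀ p, g.hom (zt p) = z.1 p := fun p => h.g_lift _
  have hd : ∀ σ τ υ, g.hom (dTwo ρ₂.toTopRep zt σ τ υ) = 0 := fun σ τ υ => by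
    rw [dTwo_apply, map_sub, map_add, map_sub, TopRep.hom_comm_apply g σ, hzt, hzt, hzt, hzt]
    exact dTwo_coe_contTwoCocycles ρ₃.toTopRep z σ τ υ
  -- the continuous `3`-cocycle `c = f⁻¹(d z̃)` of `M₁`
  let c : contThreeCocycles ρ₁.toTopRep :=
    ⟨⟨fun p => h.inv (dTwo ρ₂.toTopRep zt p.1 p.2.1 p.2.2),
        (continuous_of_discreteTopology (f := h.inv)).comp (IsSES.continuous_dTwo zt)⟩, fun σ τ υ ω => by
      apply h.injective
      have key := IsSES.dTwo_mem_contThreeCocycles (ρ₂ := ρ₂) zt σ τ υ ω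
      change ρ₂ σ (dTwo ρ₂.toTopRep zt τ υ ω) + dTwo ρ₂.toTopRep zt σ (τ * υ) ω +
          dTwo ρ₂.toTopRep zt σ τ υ =
        dTwo ρ₂.toTopRep zt (σ * τ) υ ω + dTwo ρ₂.toTopRep zt σ τ (υ * ω) at key
      change f.hom (ρ₁ σ (h.inv (dTwo ρ₂.toTopRep zt τ υ ω)) + h.inv (dTwo ρ₂.toTopRep zt σ (τ * υ) ω) +
          h.inv (dTwo ρ₂.toTopRep zt σ τ υ)) =
        f.hom (h.inv (dTwo ρ₂.toTopRep zt (σ * τ) υ ω) + h.inv (dTwo ρ₂.toTopRep zt σ τ (υ * ω)))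
      rw [map_add, map_add, map_add, ContinuousRep.hom_comm_apply f σ, h.f_inv (hd _ _ _),
        h.f_inv (hd _ _ _), h.f_inv (hd _ _ _), h.f_inv (hd _ _ _), h.f_inv (hd _ _ _)]
      exact key⟩
  -- `[c] = 0`: detected at the infinite places, where `z` is a coboundary
  have hc : threeCocycleClass ρ₁.toTopRep c = 0 := by
    refine h3 _ fun w => ?_
    haveI : CompactSpace (absoluteGaloisGroup (Place.Completion (Sum.inl w : Place K))) :=
      absoluteGaloisGroup_compactSpace _
    have loc₂ : ∀ {N : Type} [AddCommGroup N] [TopologicalSpace N] [DiscreteTopology N] (τ : DiscreteGaloisModule K N)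
        (d : contTwoCocycles τ.toTopRep),
        galoisCohomology.localization τ (Sum.inl w) 2 (twoCocycleClass τ.toTopRep d) =
          twoCocycleClass (DiscreteGaloisModule.toTopRep (τ.toLocal (Sum.inl w)))
            (contTwoCocycles.pullback (absGaloisRestrict K (Place.Completion (Sum.inl w : Place K))) (X := τ.toTopRep)
              (Y := DiscreteGaloisModule.toTopRep (τ.toLocal (Sum.inl w)))
              (TopRep.ofHom ⟨ContinuousLinearMap.id ℤ N, fun _ => rfl⟩) d) :=
      fun τ d ↦ map_twoCocycleClass _ _ _ d
    have loc₃ : ∀ {N : Type} [AddCommGroup N] [TopologicalSpace N] [DiscreteTopology N] (τ : DiscreteGaloisModule K N)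
        (d : contThreeCocycles τ.toTopRep),
        galoisCohomology.localization τ (Sum.inl w) 3 (threeCocycleClass τ.toTopRep d) =
          threeCocycleClass (DiscreteGaloisModule.toTopRep (τ.toLocal (Sum.inl w)))
            (contThreeCocycles.pullback (absGaloisRestrict K (Place.Completion (Sum.inl w : Place K))) (X := τ.toTopRep)
              (Y := DiscreteGaloisModule.toTopRep (τ.toLocal (Sum.inl w)))
              (TopRep.ofHom ⟨ContinuousLinearMap.id ℤ N, fun _ => rfl⟩) d) :=
      fun τ d ↦ map_threeCocycleClass _ _ _ d
    set r := absGaloisRestrict K (Place.Completion (Sum.inl w : Place K)) with hr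
    -- `z|_w = d b₁`
    have hxw := hx w
    rw [loc₂] at hxw
    obtain ⟨b₁, hb₁⟩ := (twoCocycleClass_eq_zero_iff _ _).1 hxw
    have hb₁' : ∀ σ τ, z.1 (r σ, r τ) = ρ₃ (r σ) (b₁ τ) - b₁ (σ * τ) + b₁ σ := fun σ τ => hb₁ σ τ
    -- a continuous lift `b₂` of `b₁`, and the `2`-cochain `e = z̃|_w - d b₂` with values in `ker g = im f`
    let b₂ : C(absoluteGaloisGroup (Place.Completion (Sum.inl w : Place K)), M₂) :=
      ⟨h.lift ∘ b₁, (continuous_of_discreteTopology (f := h.lift)).comp b₁.continuous⟩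
    have hb₂ : ∀ σ, g.hom (b₂ σ) = b₁ σ := fun σ => h.g_lift _
    let ztr : C(absoluteGaloisGroup (Place.Completion (Sum.inl w : Place K)) ×
        absoluteGaloisGroup (Place.Completion (Sum.inl w : Place K)), M₂) :=
      zt.comp ((r : C(_, absoluteGaloisGroup K)).prodMap (r : C(_, absoluteGaloisGroup K)))
    let e : C(absoluteGaloisGroup (Place.Completion (Sum.inl w : Place K)) ×
        absoluteGaloisGroup (Place.Completion (Sum.inl w : Place K)), M₂) :=
      ztr - ((ρ₂.toLocal (Sum.inl w)).twoCoboundary b₂ : contTwoCocycles _)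
    have he_apply : ∀ σ τ, e (σ, τ) = zt (r σ, r τ) - (ρ₂ (r σ) (b₂ τ) - b₂ (σ * τ) + b₂ σ) := fun σ τ => rfl
    have he : ∀ σ τ, g.hom (e (σ, τ)) = 0 := fun σ τ => by
      rw [he_apply, map_sub, map_add, map_sub, ContinuousRep.hom_comm_apply g (r σ), hzt, hb₂, hb₂, hb₂, hb₁',
        sub_self]
    -- `c|_w = d (f⁻¹ e)`
    rw [loc₃]
    refine (threeCocycleClass_eq_zero_iff_dTwo _ _).2
      ⟨⟨h.inv ∘ e, (continuous_of_discreteTopology (f := h.inv)).comp e.continuous⟩, fun σ τ υ => ?_⟩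
    apply h.injective
    change f.hom (h.inv (dTwo ρ₂.toTopRep zt (r σ) (r τ) (r υ))) =
      f.hom (ρ₁ (r σ) (h.inv (e (τ, υ))) - h.inv (e (σ * τ, υ)) + h.inv (e (σ, τ * υ)) - h.inv (e (σ, τ)))
    rw [h.f_inv (hd _ _ _), map_sub, map_add, map_sub, ContinuousRep.hom_comm_apply f (r σ), h.f_inv (he _ _),
      h.f_inv (he _ _), h.f_inv (he _ _), h.f_inv (he _ _)]
    have hde : ρ₂ (r σ) (e (τ, υ)) - e (σ * τ, υ) + e (σ, τ * υ) - e (σ, τ) =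
        dTwo (DiscreteGaloisModule.toTopRep (ρ₂.toLocal (Sum.inl w))) e σ τ υ := rfl
    rw [hde, dTwo_sub, dTwo_coe_contTwoCocycles, sub_zero, dTwo_apply, dTwo_apply]
    change _ = ρ₂ (r σ) (zt (r τ, r υ)) - zt (r (σ * τ), r υ) + zt (r σ, r (τ * υ)) - zt (r σ, r τ)
    rw [map_mul, map_mul]
    rfl
  obtain ⟨b, hb⟩ := (threeCocycleClass_eq_zero_iff_dTwo ρ₁.toTopRep c).1 hc
  have hb' : ∀ σ τ υ, dTwo ρ₂.toTopRep zt σ τ υ = f.hom (dTwo ρ₁.toTopRep b σ τ υ) := fun σ τ υ => by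
    rw [← h.f_inv (hd σ τ υ)]
    exact congrArg f.hom (hb σ τ υ)
  -- the corrected lift `z̃ - f ∘ b` is a `2`-cocycle of `M₂` mapping to `z`
  let fb : C(absoluteGaloisGroup K × absoluteGaloisGroup K, M₂) := (⟨f.hom, f.hom.continuous⟩ : C(M₁, M₂)).comp b
  have hfb : ∀ σ τ υ, dTwo ρ₂.toTopRep fb σ τ υ = f.hom (dTwo ρ₁.toTopRep b σ τ υ) := fun σ τ υ => by
    rw [dTwo_apply, dTwo_apply, map_sub, map_add, map_sub, TopRep.hom_comm_apply f σ]
    rfl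
  let y : contTwoCocycles ρ₂.toTopRep :=
    ⟨zt - fb, (mem_contTwoCocycles_iff_dTwo ρ₂.toTopRep _).2 fun σ τ υ => by
      rw [dTwo_sub, hb', hfb, sub_self]⟩
  refine ⟨twoCocycleClass _ y, ?_⟩
  rw [cohomologyMap_twoCocycleClass]
  refine congrArg _ (Subtype.ext (ContinuousMap.ext fun p => ?_))
  change g.hom (zt p - f.hom (b p)) = z.1 p
  rw [map_sub, hzt, h.g_f_apply, sub_zero]

end RelativeExactness

/-! ## §2 `Ш²(K, E[p^∞])` is `p`-divisible (`K` totally real; granted the two archimedean Poitou–Tate facts) -/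

section Functoriality

variable {F : Type} [Field F] {M₁ M₂ M₃ : Type}
  [AddCommGroup M₁] [TopologicalSpace M₁] [DiscreteTopology M₁]
  [AddCommGroup M₂] [TopologicalSpace M₂] [DiscreteTopology M₂]
  [AddCommGroup M₃] [TopologicalSpace M₃] [DiscreteTopology M₃]
  {ρ₁ : DiscreteGaloisModule F M₁} {ρ₂ : DiscreteGaloisModule F M₂} {ρ₃ : DiscreteGaloisModule F M₃}

/-- **`H²(h) ∘ H²(g) = m · H²(i)` when `h ∘ g = m · i` pointwise** (degree-`2` twin of X11b's
`Levels.map_map_eq_nsmul_map_of_comp_eq`; on classes of continuous inhomogeneous `2`-cocycles).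
[cite: SerreGaloisCohomology1997, I §2.2] -/
theorem map_two_map_two_eq_nsmul_map_two (g : ρ₂.toContRepresentation →ⁱL ρ₁.toContRepresentation)
    (h : ρ₁.toContRepresentation →ⁱL ρ₃.toContRepresentation)
    (i : ρ₂.toContRepresentation →ⁱL ρ₃.toContRepresentation) (m : ℕ)
    (hcomp : ∀ b : M₂, h (g b) = m • i b) (y : galoisCohomology ρ₂ 2) :
    galoisCohomology.map h 2 (galoisCohomology.map g 2 y) = m • galoisCohomology.map i 2 y := by
  haveI : CompactSpace (absoluteGaloisGroup F) := absoluteGaloisGroup_compactSpace F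
  obtain ⟨ψ, rfl⟩ := twoCocycleClass_surjective _ y
  have hs' : (m • twoCocycleClass ρ₂.toTopRep ψ : galoisCohomology ρ₂ 2) = twoCocycleClass ρ₂.toTopRep ((m : ℤ) • ψ) := by
    rw [twoCocycleClass_smul, Nat.cast_smul_eq_nsmul]
  rw [← map_nsmul]
  refine Eq.trans ?_ (congrArg (galoisCohomology.map i 2) hs').symm
  change cohomologyMap (DiscreteGaloisModule.homOfIntertwining h) 2
      (cohomologyMap (DiscreteGaloisModule.homOfIntertwining g) 2 (twoCocycleClass _ ψ)) =
    cohomologyMap (DiscreteGaloisModule.homOfIntertwining i) 2 (twoCocycleClass _ ((m : ℤ) • ψ))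
  rw [cohomologyMap_twoCocycleClass, cohomologyMap_twoCocycleClass, cohomologyMap_twoCocycleClass]
  refine congrArg (twoCocycleClass _) (Subtype.ext (ContinuousMap.ext fun στ ↦ ?_))
  change h (g (ψ.1 στ)) = i ((m : ℤ) • ψ.1 στ)
  rw [hcomp, map_zsmul, natCast_zsmul]

end Functoriality

section Divisible

variable {K : Type} [Field K] [NumberField K] (W : WeierstrassCurve K) [W.IsElliptic] (p : ℕ) [Fact p.Prime]

omit [Fact p.Prime] in
/-- `p ∣ p^{M+1}` in `ℤ` (the level of the kernel of `[p] : E[p^{M+1}] → E[p^M]`). [folklore] -/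
theorem natCast_dvd_pow_succ_cast (M : ℕ) : ((p : ℕ) : ℤ) ∣ ((p ^ (M + 1) : ℕ) : ℤ) :=
  Int.natCast_dvd_natCast.mpr (dvd_pow_self p M.succ_ne_zero)

omit [NumberField K] in
/-- **The finite Kummer sequence `0 → E[p] → E[p^{M+1}] →ᵖ E[p^M] → 0` is short exact** at LITERAL prime-power levels
(`torsionInclusion`, X11b's `Levels.levelMul W p M 1`; surjectivity from the divisibility of `E(K̄)`; the tree's
`torsion_isSES` is the same sequence with the middle level typed `p · p^M`). [cite: MilneADT2006, Ch. I §6, proof of Prop. 6.9] -/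
theorem isSES_torsionInclusion_levelMul (M : ℕ) :
    IsSES (DiscreteGaloisModule.homOfIntertwining (W.torsionInclusion (natCast_dvd_pow_succ_cast p M)))
      (DiscreteGaloisModule.homOfIntertwining
        (Summit.BirchSwinnertonDyer.Rank1Residual.X11b.Levels.levelMul W p M 1)) where
  comp_eq_zero := by
    ext P
    have hP : ((p : ℕ) : ℤ) • (P : W.geomPoints) = 0 := (W.mem_geomTorsion_iff _ _).mp P.2
    change ((p ^ 1 : ℕ) : ℤ) • ((P : W.geomTorsion ((p : ℕ) : ℤ)) : W.geomPoints) = 0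
    rwa [pow_one]
  injective := fun P Q h => Subtype.ext (congrArg Subtype.val h :)
  exact_mid := fun P hP => by
    have hP' : ((p ^ 1 : ℕ) : ℤ) • (P : W.geomPoints) = 0 := congrArg Subtype.val hP
    rw [pow_one] at hP'
    exact ⟨⟨(P : W.geomPoints), (W.mem_geomTorsion_iff _ _).mpr hP'⟩, Subtype.ext rfl⟩
  surjective := Summit.BirchSwinnertonDyer.Rank1Residual.X11b.Levels.levelMul_surjective W p M 1
    W.zsmul_geomPoints_surjective_holds

/-- **Halving in `Ш²(K, E[p^∞])`, `K` totally real** (Milne, *ADT*, I Lemma 6.12 / Thm. 6.13 (c), the step "the image of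
`H²(G_S, E[p^∞])` is divisible", run inside `Ш²`): granted `H³(K, M) ↪ ⊕_{v real} H³(K_v, M)` and
`H²(K, M) ↠ ⊕_{v real} H²(K_v, M)` for finite `M` (named facts, hypotheses), and the vanishing of `H²(K_v, E[p^∞])` at
the finite places (hypothesis `hfin`), every `c ∈ Ш²(K, E[p^∞])` is `p · c'` with `c' ∈ Ш²(K, E[p^∞])`.  Proof: `c = ι_M z`
with `z ∈ Ш²(K, E[p^M])` (part 4a); relative exactness (§1) along `0 → E[p] → E[p^{M+1}] →ᵖ E[p^M] → 0` lifts `z` to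
`y ∈ H²(K, E[p^{M+1}])`; at each infinite `w`, `p · y|_w = z|_w = 0`, so `y|_w = ι r_w`, `r_w ∈ H²(K_w, E[p])` (local
exactness), `r = c₀|_∞` for a global `c₀ ∈ H²(K, E[p])` (real-place surjectivity; `K` totally real); `y₁ = y - ι c₀` still
lifts `z`, is trivial at `∞`, and `c' = ι_{M+1} y₁` has `p · c' = ι_M (p y₁) = ι_M z = c`.
[cite: MilneADT2006, Ch. I, Thm. 4.10 (c), Cor. 4.16, Lemma 6.12, Thm. 6.13 (c)] -/
theorem exists_nsmul_eq_of_mem_shaTwo [IsTotallyReal K]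
    (h3 : poitouTate_three_realPlaces_injective K) (h2 : poitouTate_two_realPlaces_surjective K)
    (hfin : ∀ (v : HeightOneSpectrum (𝓞 K))
      (Z : galoisCohomology ((LocBridge.primaryGaloisModule W p).toLocal (Sum.inr v)) 2), Z = 0)
    (c : galoisCohomology (LocBridge.primaryGaloisModule W p) 2) (hc : c ∈ shaTwo (LocBridge.primaryGaloisModule W p)) :
    ∃ c' ∈ shaTwo (LocBridge.primaryGaloisModule W p), p • c' = c := by
  haveI : NeZero p := ⟨(Fact.out : p.Prime).ne_zero⟩
  haveI : Finite (W.geomTorsion ((p : ℕ) : ℤ)) := finite_geomTorsion_of_neZero W p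
  haveI : CompactSpace (absoluteGaloisGroup K) := absoluteGaloisGroup_compactSpace K
  obtain ⟨M, -, z, hz, rfl⟩ := exists_mem_shaTwo_map_primaryInclusion_eq W p c hc
  have hses := isSES_torsionInclusion_levelMul W p M
  obtain ⟨y, hy⟩ := IsSES.exists_map_two_eq_of_forall_localization_inl hses
    (fun c hc ↦ h3 _ (W.torsionGaloisModule ((p : ℕ) : ℤ)) c fun w _ ↦ hc w) z
    (fun w ↦ (mem_shaTwo_iff _ _).1 hz (Sum.inl w))
  rw [DiscreteGaloisModule.cohomologyMap_homOfIntertwining] at hy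
  have hloc : ∀ w : InfinitePlace K,
      ∃ r : galoisCohomology ((W.torsionGaloisModule ((p : ℕ) : ℤ)).toLocal (Sum.inl w)) 2,
        galoisCohomology.map ((W.torsionInclusion (natCast_dvd_pow_succ_cast p M)).restrictField w.Completion) 2 r =
          galoisCohomology.localization (W.torsionGaloisModule ((p ^ (M + 1) : ℕ) : ℤ)) (Sum.inl w) 2 y := by
    intro w
    haveI : CompactSpace (absoluteGaloisGroup (Place.Completion (Sum.inl w : Place K))) :=
      absoluteGaloisGroup_compactSpace _
    haveI : CompactSpace (absoluteGaloisGroup w.Completion) := absoluteGaloisGroup_compactSpace _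
    have hw : galoisCohomology.map
        ((Summit.BirchSwinnertonDyer.Rank1Residual.X11b.Levels.levelMul W p M 1).restrictField w.Completion) 2
          (galoisCohomology.localization (W.torsionGaloisModule ((p ^ (M + 1) : ℕ) : ℤ)) (Sum.inl w) 2 y) = 0 := by
      rw [← localization_inl_map_two, hy]
      exact (mem_shaTwo_iff _ _).1 hz (Sum.inl w)
    exact (hses.restrictField w.Completion).exists_map_two_eq_of_map_two_eq_zero _ hw
  choose r hr using hloc
  obtain ⟨c₀, hc₀⟩ := h2 _ (W.torsionGaloisModule ((p : ℕ) : ℤ)) r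
  set y₁ := y - galoisCohomology.map (W.torsionInclusion (natCast_dvd_pow_succ_cast p M)) 2 c₀ with hy₁
  have hy₁z : galoisCohomology.map (Summit.BirchSwinnertonDyer.Rank1Residual.X11b.Levels.levelMul W p M 1) 2 y₁ = z := by
    rw [hy₁, map_sub, hy, ← DiscreteGaloisModule.cohomologyMap_homOfIntertwining,
      ← DiscreteGaloisModule.cohomologyMap_homOfIntertwining (W.torsionInclusion (natCast_dvd_pow_succ_cast p M)),
      hses.map_two_map_two]
    exact sub_zero z
  have hy₁loc : ∀ w : InfinitePlace K,
      galoisCohomology.localization (W.torsionGaloisModule ((p ^ (M + 1) : ℕ) : ℤ)) (Sum.inl w) 2 y₁ = 0 := fun w ↦ by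
    rw [hy₁, map_sub, localization_inl_map_two, hc₀ w (IsTotallyReal.isReal w), hr w, sub_self]
  refine ⟨galoisCohomology.map (primaryInclusion W p (M + 1)) 2 y₁, (mem_shaTwo_iff _ _).2 ?_, ?_⟩
  · rintro (w | v)
    · rw [localization_inl_map_two, hy₁loc]
      exact map_zero _
    · exact hfin v _
  · rw [← hy₁z, map_two_map_two_eq_nsmul_map_two (Summit.BirchSwinnertonDyer.Rank1Residual.X11b.Levels.levelMul W p M 1)
      (primaryInclusion W p M) (primaryInclusion W p (M + 1)) (p ^ 1)
      (Summit.BirchSwinnertonDyer.Rank1Residual.X11b.Levels.primaryInclusion_levelMul W p M 1), pow_one]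

omit [Fact p.Prime] in
/-- **A finite, `p`-primary, `p`-divisible group is trivial** (inside an ambient additive group: a subgroup `S` on
which every element is killed by a power of `p` and is `p · (an element of S)`). [folklore] -/
theorem eq_zero_of_finite_of_primary_of_divisible {G : Type} [AddCommGroup G] (S : AddSubgroup G) [Finite S]
    (hprim : ∀ c ∈ S, ∃ n : ℕ, p ^ n • c = 0) (hdiv : ∀ c ∈ S, ∃ c' ∈ S, p • c' = c) :
    ∀ c ∈ S, c = 0 := by
  -- multiplication by `p` on `S` is onto, hence injective
  have hsurj : Function.Surjective fun x : S ↦ p • x := fun x ↦ by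
    obtain ⟨c', hc', h⟩ := hdiv x.1 x.2
    exact ⟨⟨c', hc'⟩, Subtype.ext h⟩
  have hinj : Function.Injective fun x : S ↦ p • x := Finite.injective_iff_surjective.mpr hsurj
  have key : ∀ (n : ℕ) (x : S), p ^ n • x = 0 → x = 0 := by
    intro n
    induction n with
    | zero => intro x hx; simpa using hx
    | succ n ih =>
      intro x hx
      rw [pow_succ, mul_smul] at hx
      have h0 : p • x = 0 := ih _ hx
      exact hinj (by simpa using h0.trans (smul_zero p).symm)
  intro c hc
  obtain ⟨n, hn⟩ := hprim c hc
  have := key n ⟨c, hc⟩ (Subtype.ext (by simpa using hn))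
  exact congrArg Subtype.val this

/-- **`Ш²(K, E[p^∞]) = 0`** for `K` totally real, `Sel_{p^∞}(E/K)` finite and `E[p^∞]^{Γ_K} = 0`, granted Poitou–Tate
duality of `Ш` at finite level (`poitouTate_sha_tateDual K`: FINITE, part 4a), the two archimedean Poitou–Tate facts
(`p`-DIVISIBLE, above) and the vanishing of the local `H²(K_v, E[p^∞])` at finite places (`hfin`): finite +
`p`-primary (X11b `WeakLeopoldt.exists_pow_smul_eq_zero`) + `p`-divisible ⇒ `0`.
[cite: MilneADT2006, Ch. I, Thm. 4.10, Cor. 4.16, Thm. 6.13 (c)] [cite: Harari2020, Thm. 17.13 (b)] -/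
theorem forall_mem_shaTwo_primary_eq_zero [IsTotallyReal K] (hPT : poitouTate_sha_tateDual K)
    (h3 : poitouTate_three_realPlaces_injective K) (h2 : poitouTate_two_realPlaces_surjective K)
    (hfin : ∀ (v : HeightOneSpectrum (𝓞 K))
      (Z : galoisCohomology ((LocBridge.primaryGaloisModule W p).toLocal (Sum.inr v)) 2), Z = 0)
    [Finite (W.selmerGroupPInfty p)]
    (hΓ : ∀ Q : W.geomPrimaryTorsion p, (∀ σ : absoluteGaloisGroup K, LocBridge.primaryGaloisModule W p σ Q = Q) → Q = 0) :
    ∀ c ∈ shaTwo (LocBridge.primaryGaloisModule W p), c = 0 := by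
  haveI := (finite_shaTwo_primary_and_natCard_le W p hPT hΓ).1
  exact eq_zero_of_finite_of_primary_of_divisible p (shaTwo (LocBridge.primaryGaloisModule W p))
    (fun c _ ↦ Summit.BirchSwinnertonDyer.Rank1Residual.X11b.WeakLeopoldt.exists_pow_smul_eq_zero W p c)
    (fun c hc ↦ exists_nsmul_eq_of_mem_shaTwo W p h3 h2 hfin c hc)

end Divisible

/-! ## §3 Over `ℚ` at `p = 2` with `GoodSS W 2`: `Ш²(ℚ, E[2^∞]) = 0`, and `hres` discharged -/

section Rat

variable (W : WeierstrassCurve ℚ) [W.IsElliptic] [W.IsGloballyMinimal]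

/-- **`H²(ℚ_v, E[2^∞]) = 0` at every finite `v`** for `W/ℚ` good supersingular at `2` (part 3: `v ∣ 2` from «`E(ℚ₂)[2] = 0`»,
`v ∤ 2` X11b with the proved local Euler–Poincaré characteristic). [cite: JetchevSkinnerWan2017, Lemma 3.3.3 (arXiv:1512.06894 p. 12)] -/
theorem localization_inr_two_primary_eq_zero_of_goodSS (hss : Literature.NumberTheory.EllipticCurves.Rank1Residual.GoodSS W 2)
    (v : HeightOneSpectrum (𝓞 ℚ))
    (Z : galoisCohomology ((LocBridge.primaryGaloisModule W 2).toLocal (Sum.inr v)) 2) : Z = 0 := by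
  by_cases hv : (2 : 𝓞 ℚ) ∈ v.asIdeal
  · exact ResTwo.galoisCohomology_two_primary_eq_zero_of_exponent W 2 v
      (ResTwo.pow_smul_eq_zero_exponent_zero_of_goodSS W hss v hv) _
  · haveI : CharZero (v.adicCompletion ℚ) :=
      charZero_of_injective_algebraMap (algebraMap ℚ (v.adicCompletion ℚ)).injective
    exact Summit.BirchSwinnertonDyer.Rank1Residual.X11b.Levels.galoisCohomology_two_primary_eq_zero W 2 v
      (localEulerPoincareCharacteristic_holds (v.adicCompletion ℚ)) hv _

/-- **`Ш²(ℚ, E[2^∞]) = 0` on the K4 row** (`GoodSS W 2`, `Sel_{2^∞}(E/ℚ)` finite), granted `poitouTate_sha_tateDual ℚ`,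
`poitouTate_three_realPlaces_injective ℚ`, `poitouTate_two_realPlaces_surjective ℚ` (cited Poitou–Tate rows; hypotheses
by name): `E(ℚ)[2] = 0` at good supersingular `2` gives `E[2^∞]^{Γ_ℚ} = 0`, `ℚ` is totally real, and §2 applies.
[cite: MilneADT2006, Ch. I, Thm. 4.10, Cor. 4.16, Thm. 6.13 (c)] [cite: GreenbergLNM1716, §4 p. 119] -/
theorem forall_mem_shaTwo_two_primary_eq_zero_of_goodSS
    (hss : Literature.NumberTheory.EllipticCurves.Rank1Residual.GoodSS W 2) (hPT : poitouTate_sha_tateDual ℚ)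
    (h3 : poitouTate_three_realPlaces_injective ℚ) (h2 : poitouTate_two_realPlaces_surjective ℚ)
    [Finite (W.selmerGroupPInfty 2)] : ∀ c ∈ shaTwo (LocBridge.primaryGaloisModule W 2), c = 0 := by
  have hirr := (Summit.BirchSwinnertonDyer.Rank1Residual.X5.O1.irr_two_iff_forall_two_nsmul W).mp
    (Summit.BirchSwinnertonDyer.Rank1Residual.P2.irr_two_of_goodSS_two W hss)
  exact forall_mem_shaTwo_primary_eq_zero W 2 hPT h3 h2 (localization_inr_two_primary_eq_zero_of_goodSS W hss)
    fun Q hQ ↦ W.eq_zero_of_forall_smul_eq (p := 2) (fun P hP ↦ hirr P (by convert hP)) fun σ ↦ hQ σ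

/-- **The v11 stub `stub_shaTwoPrimaryVanishing` of line `eulerchar` (crux K4, skeleton sha16 50a2041f5216dbea), VERBATIM
binder shape, CONDITIONAL on the three cited Poitou–Tate rows** `poitouTate_sha_tateDual ℚ` (Milne I 4.10 (a)),
`poitouTate_three_realPlaces_injective ℚ` (4.10 (c), `r = 3`), `poitouTate_two_realPlaces_surjective ℚ` (Cor. 4.16) — named
facts taken as hypotheses (a `conditional-result`; the `a₂ = 0` binder is idle). With it the v11 composition reads
`hres := ResTwo.resTwo_injective_of_shaTwo W κ hss (stub_shaTwoPrimaryVanishing_of_poitouTate hPT h3 h2 W hss ha hSel)`.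
[cite: MilneADT2006, Ch. I, Thm. 4.10 (a),(c), Cor. 4.16, Thm. 6.13 (c)] [cite: GreenbergLNM1716, §4 p. 119 (the rôle of Prop. 4.12)] -/
theorem stub_shaTwoPrimaryVanishing_of_poitouTate (hPT : poitouTate_sha_tateDual ℚ)
    (h3 : poitouTate_three_realPlaces_injective ℚ) (h2 : poitouTate_two_realPlaces_surjective ℚ) :
    ∀ (W : WeierstrassCurve ℚ) [W.IsElliptic] [W.IsGloballyMinimal],
      Literature.NumberTheory.EllipticCurves.Rank1Residual.GoodSS W 2 → W.frobeniusTrace 2 = 0 →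
        Finite (W.selmerGroupPInfty 2) → ∀ c ∈ shaTwo (LocBridge.primaryGaloisModule W 2), c = 0 :=
  fun W _ _ hss _ hSel ↦ by
    haveI := hSel
    exact forall_mem_shaTwo_two_primary_eq_zero_of_goodSS W hss hPT h3 h2

end Rat

end Summit.BirchSwinnertonDyer.BirchSwinnertonDyer.Theorems.SignedEC.ShaTwo
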